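import Summits.HodgeConjecture.CorCM.Census.OddDegreeParityLawCyclicPrime
import Mathlib.Data.ZMod.QuotientGroup

/-!
# The odd-degree parity law, III: relative Weil vectors (the law without `E`) and the orbit count for every odd abelian `A`

COR-CM (cell `pub-hodgecm2`), count-neutral kernel census by the binder seat b17 (gen 49; claim ODD-PARITY-LAW-III), sequel of
`Census/OddDegreeParityLaw.lean` (I) and `Census/OddDegreeParityLawCyclicPrime.lean` (II), whose dictionary, model and notation are
used verbatim.  Theorems + three bookkeeping definitions, Mathlib-only mathematics, three `decide`s on sums of `≤ 15` terms, no named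
fact, no `sorry`.  HC_CM is not proved anywhere in this cell; nothing here is a headline and nothing here produces a period.

§1 THE LAW WITHOUT `E` (removes the hypothesis «`E` among the blocks» of I).  For two blocks `b, b'` of the odd slice model the
RELATIVE WEIL VECTOR `w_{b,b'} = d(b')·half(b) − d(b)·half(b')` (`relWeilVec`; `d` = signature defect `defect`, `half` = the
`k`-eigen-half monomial, both from I) is a Hodge vector for ANY two blocks (`relWeilVec_mem`: each Pohlmann form takes the value
`±d(b)` on `half(b)` with ONE sign for all blocks, I `hodgeVec_dotProduct_half`), and its block parity is `e_b + e_{b'}` as soon as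
`|A_b|` and `|A_{b'}|` are odd (`parity_relWeilVec`).  Dictionary: every simple factor `B_b` of an odd slice has CM field
`K_b = F^{0 × Per(φ_b)} ⊇ k = F^A`, the imaginary quadratic subfield, acting with multiplicities `(n₀(b), |A_b| − n₀(b))` of odd
defect `d(b)`; so `B_b^{|d(b')|} × B_{b'}^{|d(b)|}` — `k` acting on one factor through the conjugate structure when `d(b)d(b') > 0` —
is of Weil type for `k`, and `w_{b,b'}` is, up to pairs and sign, the exponent vector of its Weil class [cite: Weil1977HodgeRing;
Gordon1999HodgeAVSurvey, §7]; for `b' = e` (`A_e = 0`, `d(e) = ±1`) it is `±` the Weil vector `weilVec` of I modulo pairs.  Hence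
(**`card_le_card_add_one_of_generates_odd`**, **`card_sub_one_le_card_of_generates_odd`**): in EVERY odd slice — any finite family
of blocks with odd label groups, `E` present or not, in particular every sub-slice of the faithful slice of a Galois CM type `(G, c)`
with `|G| ≡ 2 (mod 4)` (II §1) — `hodgeLattice ≤ pairs ⊔ ℤ[G]·S ⟹ |S| ≥ |ι| − 1`.  E.g. for any two non-isogenous simple factors
`B, B'` of one odd Galois slice some `B^m × B'^{m'}` carries a Hodge vector outside the lattice of the divisor classes (`|S| ≥ 1`).

§2 THE ORBIT COUNT FOR EVERY ABELIAN `A` OF ODD ORDER (II decided only `A = ℤ/p`).  The translation `(0, y₀)` fixes exactly the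
nonconstant types pulled back from `A / ℤy₀` (`fixedByEquiv`, via `descendLE`), `2^{|A / ℤy₀|} − 2` of them (`card_fixedBy_zero`, II
`card_nonconst`); `(1, y₀)` fixes none (`fixedBy_one_eq_empty`: no anti-periods in odd order, II `stabiliser_fst_eq_zero`); Burnside:
**`card_orbitsA_mul`**: `#OrbitsA(A) · 2|A| = Σ_{y ∈ A} (2^{|A / ℤy|} − 2)`.  Decided instance: `(ℤ/3)²: 31` (`card_orbitsA_zmod_three_sq`;
`4` classes of CM threefolds, one for each subgroup of order `3`, and `27` classes of ninefolds with CM by `F`).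

§3 CYCLIC `A = ℤ/n`, `n` odd: `|ℤ/n : ℤy| = gcd(n, y)` (`card_quotient_zmultiples_zmod`), so **`card_orbitsA_zmod_mul`**:
`#orbits · 2n = Σ_{a<n} (2^{gcd(n,a)} − 2)` — the number of binary necklaces of odd length `n` up to rotation and complementation
(`2, 4, 10, 30, 1096` at `n = 3, 5, 7, 9, 15`; OEIS A000013) minus the constant one: `ℤ/9: 29`, `ℤ/15: 1095` (`card_orbitsA_zmod_nine`,
`card_orbitsA_zmod_fifteen`).  With II `oddSlice_law`: **`oddCyclic_law`**: `μ(ℤ/2n) ≥ (Σ_{a<n} (2^{gcd(n,a)} − 2)) / 2n` for every odd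
`n` (II `cyclicPrime_law` is the prime case), and the three numeric laws quoted without proof in the headers of I and II:
`μ(ℤ/18) ≥ 29`, `μ(ℤ/30) ≥ 1095`, `μ(ℤ/6 × ℤ/3) ≥ 31` (`zmod_eighteen_law`, `zmod_thirty_law`, `zmod_six_three_law`).
NOT CLAIMED: any upper bound on `μ`; `|G| ≡ 0 (mod 4)` (there hypothesis and conclusion fail together: the full slice of the
biquadratic field is `{E₁, E₂}`, two CM elliptic curves with different CM fields, `μ = 0 < |ι| − 1`); non-abelian odd complements.
Presearch (corpus fts + vec, galaxy): necklace counting is textbook Pólya–Burnside theory; primitive CM types `↔` simple factors and,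
for abelian `G`, primitive `⟺` trivial stabiliser: Schmidt, LNM 1082, Kap. II §1 (Bem. 1.5, Satz 1.6 (Schappacher), Bem. 1.13),
[Milne1999, Prop. 2.1]; no printed source found for the parity law or for these slice counts.

## References
* [Pohlmann1968] H. Pohlmann, Algebraic cycles on abelian varieties of complex multiplication type, Ann. of Math. 88 (1968), Thm 1.
* [Milne1999] J. S. Milne, Lefschetz motives and the Tate conjecture, Compositio Math. 117 (1999), Prop. 2.1, p. 54.
* [Weil1977HodgeRing] A. Weil, Abelian varieties and the Hodge ring, Œuvres Scientifiques III, [1977c], 421–429.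
* [Gordon1999HodgeAVSurvey] B. B. Gordon, A survey of the Hodge conjecture for abelian varieties, Appendix B in J. D. Lewis,
  A Survey of the Hodge Conjecture, 2nd ed., CRM Monograph Series 10 (1999), §7.
* C.-G. Schmidt, Arithmetik Abelscher Varietäten mit komplexer Multiplikation, Lecture Notes in Math. 1082, Springer (1984), Kap. II.
-/

namespace Summit.HodgeConjecture.CorCM.Census.OddDegreeParityLaw

open Finset

/-! ## §1 Relative Weil vectors: the law for every odd slice, with or without `E` -/

section Relative

variable {A : Type*} [AddCommGroup A]
variable {ι : Type*} [Fintype ι] [DecidableEq ι]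
variable {Ab : ι → Type*} [∀ b, AddCommGroup (Ab b)] [∀ b, Fintype (Ab b)] [∀ b, DecidableEq (Ab b)]

/-- **The relative Weil vector** of two blocks `b, b'`: `d(b') · half(b) − d(b) · half(b')`. [folklore] -/
def relWeilVec (φ : ∀ b, Ab b → ZMod 2) (b b' : ι) : Pt Ab → ℤ :=
  defect φ b' • half b - defect φ b • half b'

omit [∀ b, DecidableEq (Ab b)] in
/-- **Relative Weil vectors are Hodge vectors** (no hypothesis on the blocks). [folklore] -/
theorem relWeilVec_mem (π : ∀ b, A →+ Ab b) (φ : ∀ b, Ab b → ZMod 2) (b b' : ι) :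
    relWeilVec φ b b' ∈ hodgeLattice π φ := by
  intro g
  show hodgeVec π φ g ⬝ᵥ (defect φ b' • half b - defect φ b • half b') = 0
  rw [dotProduct_sub, dotProduct_smul, dotProduct_smul, hodgeVec_dotProduct_half, hodgeVec_dotProduct_half]
  split_ifs <;> simp only [smul_eq_mul] <;> ring

omit [Fintype ι] [∀ b, AddCommGroup (Ab b)] [∀ b, DecidableEq (Ab b)] in
/-- **Parity of the relative Weil vector**: `e_b + e_{b'}` when `|A_b|` and `|A_{b'}|` are odd. [folklore] -/
theorem parity_relWeilVec (φ : ∀ b, Ab b → ZMod 2) (b b' : ι) (hb : Odd (Fintype.card (Ab b)))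
    (hb' : Odd (Fintype.card (Ab b'))) :
    parity (relWeilVec φ b b') = Pi.single b 1 + Pi.single b' 1 := by
  have hN : ∀ b₁ : ι, Odd (Fintype.card (Ab b₁)) → (Fintype.card (Ab b₁) : ZMod 2) = 1 := fun b₁ h =>
    (ZMod.natCast_eq_one_iff_odd).mpr h
  have hd : ∀ b₁ : ι, Odd (Fintype.card (Ab b₁)) → ((defect φ b₁ : ℤ) : ZMod 2) = 1 := by
    intro b₁ h
    unfold defect
    push_cast
    rw [hN b₁ h]
    have h2 : (2 : ZMod 2) = 0 := by decide
    rw [h2, zero_mul, zero_sub]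
    decide
  unfold relWeilVec
  rw [map_sub, map_zsmul, map_zsmul, parity_half, parity_half]
  funext b₁
  rw [Pi.sub_apply, Pi.smul_apply, Pi.smul_apply, Pi.add_apply]
  simp only [zsmul_eq_mul, hd b hb, hd b' hb', one_mul, Pi.single_apply, hN b hb, hN b' hb', sub_eq_add_neg,
    ZMod.neg_eq_self_mod_two]

/-- The parities of `P + ℤ[G]·S` lie in the `𝔽₂`-span of the parities of `S`. [folklore] -/
theorem parity_mem_span_of_mem (π : ∀ b, A →+ Ab b) (S : Finset (Pt Ab → ℤ)) (v : Pt Ab → ℤ)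
    (hv : v ∈ pairs ⊔ Submodule.span ℤ {v | ∃ g : ZMod 2 × A, ∃ t ∈ S, v = transl π g t}) :
    parity v ∈ Submodule.span (ZMod 2) ((S.image parity : Finset (ι → ZMod 2)) : Set (ι → ZMod 2)) := by
  classical
  let T : Finset (ι → ZMod 2) := S.image parity
  let W : Submodule ℤ (ι → ZMod 2) := (Submodule.span (ZMod 2) (T : Set (ι → ZMod 2))).restrictScalars ℤ
  have hle : pairs ⊔ Submodule.span ℤ {v | ∃ g : ZMod 2 × A, ∃ t ∈ S, v = transl π g t} ≤ W.comap parity := by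
    refine sup_le (Submodule.span_le.mpr ?_) (Submodule.span_le.mpr ?_)
    · rintro _ ⟨x, rfl⟩
      simp only [SetLike.mem_coe, Submodule.mem_comap, W, Submodule.restrictScalars_mem, parity_pairVec]
      exact Submodule.zero_mem _
    · rintro _ ⟨g, t, ht, rfl⟩
      have hmem : parity t ∈ (T : Set (ι → ZMod 2)) := by
        simp only [T, Finset.coe_image]
        exact Set.mem_image_of_mem parity ht
      simp only [SetLike.mem_coe, Submodule.mem_comap, W, Submodule.restrictScalars_mem, parity_transl]
      exact Submodule.subset_span hmem
  exact hle hv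

/-- **THE ODD PARITY LAW WITHOUT `E`.**  In any odd slice (all label groups `A_b` of odd order), with or without the block of the CM
elliptic curve: if the Hodge lattice is generated, together with the divisor classes, by the Galois translates of a finite family
`S`, then `|ι| ≤ |S| + 1`. [folklore] -/
theorem card_le_card_add_one_of_generates_odd (π : ∀ b, A →+ Ab b) (φ : ∀ b, Ab b → ZMod 2)
    (hodd : ∀ b, Odd (Fintype.card (Ab b))) (S : Finset (Pt Ab → ℤ))
    (hS : hodgeLattice π φ ≤ pairs ⊔ Submodule.span ℤ {v | ∃ g : ZMod 2 × A, ∃ t ∈ S, v = transl π g t}) :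
    Fintype.card ι ≤ S.card + 1 := by
  classical
  rcases isEmpty_or_nonempty ι with hι | ⟨⟨b₀⟩⟩
  · simp
  have hsum : ∀ b : ι, (Pi.single b 1 + Pi.single b₀ 1 : ι → ZMod 2) ∈
      Submodule.span (ZMod 2) ((S.image parity : Finset (ι → ZMod 2)) : Set (ι → ZMod 2)) := by
    intro b
    have h := parity_mem_span_of_mem π S _ (hS (relWeilVec_mem π φ b b₀))
    rwa [parity_relWeilVec φ b b₀ (hodd b) (hodd b₀)] at h
  have hT : (S.image parity).card ≤ S.card := Finset.card_image_le
  exact (card_le_card_add_one_of_forall_add_single_mem b₀ _ hsum).trans (by omega)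

/-- **THE ODD PARITY LAW WITHOUT `E`, `μ ≥ |ι| − 1` form.** [folklore] -/
theorem card_sub_one_le_card_of_generates_odd (π : ∀ b, A →+ Ab b) (φ : ∀ b, Ab b → ZMod 2)
    (hodd : ∀ b, Odd (Fintype.card (Ab b))) (S : Finset (Pt Ab → ℤ))
    (hS : hodgeLattice π φ ≤ pairs ⊔ Submodule.span ℤ {v | ∃ g : ZMod 2 × A, ∃ t ∈ S, v = transl π g t}) :
    Fintype.card ι - 1 ≤ S.card := by
  have h := card_le_card_add_one_of_generates_odd π φ hodd S hS
  omega

end Relative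

/-! ## §2 The orbit count for every abelian `A` of odd order (Burnside) -/

section Burnside

variable (A : Type) [AddCommGroup A]

variable {A} in
/-- `y₀`-periodicity in the `shift` form `φ(y − y₀) = φ(y)` is membership of `y₀` in `Per(φ)`. [folklore] -/
theorem sub_periodic_iff (φ : A → ZMod 2) (y₀ : A) : (∀ y, φ (y - y₀) = φ y) ↔ y₀ ∈ periods φ := by
  constructor
  · intro h y
    have := h (y + y₀)
    rw [add_sub_cancel_right] at this
    exact this.symm
  · intro h y
    have := h (y - y₀)
    rw [sub_add_cancel] at this
    exact this.symm

variable {A} in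
/-- Descent of a type along a subgroup of periods. [folklore] -/
def descendLE (H : AddSubgroup A) (φ : A → ZMod 2) (h : H ≤ periods φ) : A ⧸ H → ZMod 2 :=
  Quotient.lift (s := QuotientAddGroup.leftRel H) φ (fun x y hxy => by
    have h' : -x + y ∈ H := QuotientAddGroup.leftRel_apply.mp hxy
    have := h h' x
    rw [add_neg_cancel_left] at this
    exact this.symm)

variable {A} in
/-- A map pulled back from a quotient is constant iff it is constant on the quotient. [folklore] -/
theorem const_comp_mk_iff (H : AddSubgroup A) (ψ : A ⧸ H → ZMod 2) :
    (∀ y : A, ψ (y : A ⧸ H) = ψ ((0 : A) : A ⧸ H)) ↔ ∀ q, ψ q = ψ 0 := by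
  constructor
  · intro h q
    induction q using QuotientAddGroup.induction_on with
    | H z => rw [h z, QuotientAddGroup.mk_zero]
  · intro h y
    rw [h, QuotientAddGroup.mk_zero]

/-- **Fixed points of a translation.**  The nonconstant types fixed by `(0, y₀)` are the nonconstant types of the quotient
`A ⧸ ℤy₀`. [folklore] -/
noncomputable def fixedByEquiv (y₀ : A) :
    AddAction.fixedBy (Nonconst A) (((0 : ZMod 2), y₀) : ZMod 2 × A) ≃
      Nonconst (A ⧸ AddSubgroup.zmultiples y₀) where
  toFun φ :=
    have hper : AddSubgroup.zmultiples y₀ ≤ periods φ.1.1 := by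
      rw [AddSubgroup.zmultiples_le, ← sub_periodic_iff]
      intro y
      have := congrArg (fun ψ : Nonconst A => ψ.1 y) (AddAction.mem_fixedBy.mp φ.2)
      simpa [vadd_val] using this
    ⟨descendLE _ φ.1.1 hper, fun hc => φ.1.2 ((const_comp_mk_iff _ _).mpr hc)⟩
  invFun ψ :=
    ⟨⟨fun y => ψ.1 (y : A ⧸ AddSubgroup.zmultiples y₀), fun hc => ψ.2 ((const_comp_mk_iff _ ψ.1).mp hc)⟩, by
      rw [AddAction.mem_fixedBy]
      apply Subtype.ext
      funext y
      rw [vadd_val]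
      show ψ.1 ((y - y₀ : A) : A ⧸ AddSubgroup.zmultiples y₀) + 0 = ψ.1 (y : A ⧸ AddSubgroup.zmultiples y₀)
      have hq : ((y - y₀ : A) : A ⧸ AddSubgroup.zmultiples y₀) = (y : A ⧸ AddSubgroup.zmultiples y₀) := by
        rw [QuotientAddGroup.eq]
        have : -(y - y₀) + y = y₀ := by abel
        rw [this]
        exact AddSubgroup.mem_zmultiples y₀
      rw [add_zero, hq]⟩
  left_inv φ := by
    apply Subtype.ext
    apply Subtype.ext
    funext y
    rfl
  right_inv ψ := by
    apply Subtype.ext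
    funext q
    induction q using QuotientAddGroup.induction_on with
    | H z => rfl

/-- **The number of fixed points of `(0, y₀)`** on the nonconstant types is `2^{|A / ℤy₀|} − 2`. [folklore] -/
theorem card_fixedBy_zero [Finite A] (y₀ : A) :
    Nat.card (AddAction.fixedBy (Nonconst A) (((0 : ZMod 2), y₀) : ZMod 2 × A)) =
      2 ^ Nat.card (A ⧸ AddSubgroup.zmultiples y₀) - 2 := by
  classical
  rw [Nat.card_congr (fixedByEquiv A y₀)]
  letI : Fintype (A ⧸ AddSubgroup.zmultiples y₀) := Fintype.ofFinite _
  rw [Nat.card_eq_fintype_card, card_nonconst, Nat.card_eq_fintype_card]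

/-- **No fixed points of `(1, y₀)`** (complement after translation) when `|A|` is odd: no anti-periods. [folklore] -/
theorem fixedBy_one_eq_empty [Fintype A] (hA : Odd (Fintype.card A)) (y₀ : A) :
    AddAction.fixedBy (Nonconst A) (((1 : ZMod 2), y₀) : ZMod 2 × A) = ∅ := by
  ext φ
  simp only [AddAction.mem_fixedBy, Set.mem_empty_iff_false, iff_false]
  intro h
  have h' : ∀ y, φ.1 (y - y₀) + 1 = φ.1 y := fun y => by
    have := congrArg (fun ψ : Nonconst A => ψ.1 y) h
    simpa [vadd_val] using this
  exact absurd (stabiliser_fst_eq_zero hA φ.1 1 y₀ h').1 (by decide)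

/-- **THE ORBIT COUNT (Burnside).**  For `|A|` odd, the number of `G`-orbits of nonconstant types — isogeny classes of simple CM
abelian varieties split by `F` other than `E` — satisfies `#orbits · 2|A| = Σ_{y ∈ A} (2^{|A / ℤy|} − 2)`. [folklore] -/
theorem card_orbitsA_mul [Fintype A] (hA : Odd (Fintype.card A)) :
    Nat.card (OrbitsA A) * (2 * Fintype.card A) =
      ∑ y : A, (2 ^ Nat.card (A ⧸ AddSubgroup.zmultiples y) - 2) := by
  classical
  have h01 : ∀ a : ZMod 2, a = 0 ∨ a = 1 := by decide
  have burnside :=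
    AddAction.sum_card_fixedBy_eq_card_orbits_mul_card_addGroup (ZMod 2 × A) (Nonconst A)
  rw [Fintype.card_prod, ZMod.card] at burnside
  have hfix : ∀ g : ZMod 2 × A, Fintype.card (AddAction.fixedBy (Nonconst A) g) =
      if g.1 = 0 then 2 ^ Nat.card (A ⧸ AddSubgroup.zmultiples g.2) - 2 else 0 := by
    rintro ⟨a, y⟩
    rcases h01 a with rfl | rfl
    · rw [if_pos rfl, ← Nat.card_eq_fintype_card]
      exact card_fixedBy_zero A y
    · rw [if_neg (by simp), Fintype.card_eq_zero_iff]
      refine ⟨fun ⟨φ, hφ⟩ => ?_⟩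
      have he := fixedBy_one_eq_empty A hA y
      rw [he] at hφ
      exact hφ
  simp_rw [hfix] at burnside
  rw [Fintype.sum_prod_type_right] at burnside
  simp only [Finset.sum_ite_eq', Finset.mem_univ, if_true] at burnside
  rw [Nat.card_eq_fintype_card]
  exact burnside.symm


/-- `ℤ/6 × ℤ/3`: `31` isogeny classes of simple CM abelian varieties other than `E` are split by a Galois CM field with group
`ℤ/2 × (ℤ/3)²` (one class of threefolds for each of the `4` subgroups of order `3`, and `27` classes of ninefolds). [folklore] -/
theorem card_orbitsA_zmod_three_sq : Nat.card (OrbitsA (ZMod 3 × ZMod 3)) = 31 := by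
  have hA : Odd (Fintype.card (ZMod 3 × ZMod 3)) := by rw [Fintype.card_prod, ZMod.card]; decide
  have h := card_orbitsA_mul (ZMod 3 × ZMod 3) hA
  have h3y : ∀ y : ZMod 3 × ZMod 3, 3 • y = 0 := by decide
  have hq : ∀ y : ZMod 3 × ZMod 3,
      Nat.card ((ZMod 3 × ZMod 3) ⧸ AddSubgroup.zmultiples y) = if y = 0 then 9 else 3 := by
    intro y
    have hl := AddSubgroup.card_eq_card_quotient_mul_card_addSubgroup (AddSubgroup.zmultiples y)
    rw [Nat.card_zmultiples, Nat.card_eq_fintype_card (α := ZMod 3 × ZMod 3), Fintype.card_prod, ZMod.card] at hl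
    by_cases hy : y = 0
    · subst hy
      rw [addOrderOf_zero, mul_one] at hl
      rw [if_pos rfl]
      omega
    · rw [if_neg hy]
      have h3 : addOrderOf y = 3 := by
        rcases (Nat.dvd_prime Nat.prime_three).mp (addOrderOf_dvd_of_nsmul_eq_zero (h3y y)) with h1 | h3
        · exact absurd (AddMonoid.addOrderOf_eq_one_iff.mp h1) hy
        · exact h3
      rw [h3] at hl
      omega
  simp_rw [hq] at h
  have hs : (∑ y : ZMod 3 × ZMod 3, (2 ^ (if y = 0 then 9 else 3) - 2)) = 558 := by decide
  rw [hs, Fintype.card_prod, ZMod.card] at h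
  omega

end Burnside

/-! ## §3 Cyclic `A = ℤ/n`, `n` odd: `#orbits · 2n = Σ_{a<n} (2^{gcd(n,a)} − 2)`; `μ(ℤ/18) ≥ 29`, `μ(ℤ/30) ≥ 1095` -/

section Cyclic

/-- The index of `ℤy` in `ℤ/n` is `gcd(n, y)`. [folklore] -/
theorem card_quotient_zmultiples_zmod (n : ℕ) [NeZero n] (y : ZMod n) :
    Nat.card (ZMod n ⧸ AddSubgroup.zmultiples y) = n.gcd y.val := by
  have h := AddSubgroup.card_eq_card_quotient_mul_card_addSubgroup (AddSubgroup.zmultiples y)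
  rw [Nat.card_zmultiples, Nat.card_eq_fintype_card (α := ZMod n), ZMod.card] at h
  have ho : addOrderOf y = n / n.gcd y.val := by
    conv_lhs => rw [← ZMod.natCast_zmod_val y]
    exact ZMod.addOrderOf_coe y.val (NeZero.ne n)
  rw [ho] at h
  have hgpos : 0 < n.gcd y.val := Nat.gcd_pos_of_pos_left _ (NeZero.pos n)
  obtain ⟨k, hk⟩ := Nat.gcd_dvd_left n y.val
  have hk' : n / n.gcd y.val = k := Nat.div_eq_of_eq_mul_left hgpos (hk.trans (mul_comm _ _))
  rw [hk'] at h
  have hkpos : 0 < k := by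
    rcases Nat.eq_zero_or_pos k with h0 | h0
    · rw [h0, mul_zero] at hk; exact absurd hk (NeZero.ne n)
    · exact h0
  exact Nat.eq_of_mul_eq_mul_right hkpos (h.symm.trans hk)

/-- **The orbit count for `ℤ/2 × ℤ/n`, `n` odd**: `#orbits · 2n = Σ_{a < n} (2^{gcd(n,a)} − 2)` (binary necklaces of length `n` up to
rotation and complement, minus the constant one). [folklore] -/
theorem card_orbitsA_zmod_mul (n : ℕ) [NeZero n] (hn : Odd n) :
    Nat.card (OrbitsA (ZMod n)) * (2 * n) = ∑ a ∈ Finset.range n, (2 ^ n.gcd a - 2) := by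
  have hA : Odd (Fintype.card (ZMod n)) := by rwa [ZMod.card]
  have h := card_orbitsA_mul (ZMod n) hA
  rw [ZMod.card] at h
  rw [h]
  simp_rw [card_quotient_zmultiples_zmod]
  obtain ⟨k, rfl⟩ := Nat.exists_eq_succ_of_ne_zero (NeZero.ne n)
  exact Fin.sum_univ_eq_sum_range (fun a => 2 ^ (k + 1).gcd a - 2) (k + 1)

/-- `ℤ/18`: `29` isogeny classes of simple CM abelian varieties other than `E` are split by a cyclic CM field of degree `18`. [folklore] -/
theorem card_orbitsA_zmod_nine : Nat.card (OrbitsA (ZMod 9)) = 29 := by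
  have h := card_orbitsA_zmod_mul 9 (by decide)
  have hs : ∑ a ∈ Finset.range 9, (2 ^ Nat.gcd 9 a - 2) = 522 := by decide
  omega

/-- `ℤ/30`: `1095` isogeny classes of simple CM abelian varieties other than `E` are split by a cyclic CM field of degree `30`. [folklore] -/
theorem card_orbitsA_zmod_fifteen : Nat.card (OrbitsA (ZMod 15)) = 1095 := by
  have h := card_orbitsA_zmod_mul 15 (by decide)
  have hs : ∑ a ∈ Finset.range 15, (2 ^ Nat.gcd 15 a - 2) = 32850 := by decide
  omega

/-- **`μ(ℤ/2n) ≥ (Σ_{a<n} (2^{gcd(n,a)} − 2)) / 2n`** for every odd `n`: the faithful full slice of the cyclic Galois CM type of degree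
`2n` needs at least that many Galois orbits of generators on top of the divisor classes. [folklore] -/
theorem oddCyclic_law (n : ℕ) [NeZero n] (hn : Odd n) (S : Finset (Pt (AbQ (ZMod n)) → ℤ))
    (hS : hodgeLattice (πQ (ZMod n)) (φQ (ZMod n)) ≤
      pairs ⊔ Submodule.span ℤ {v | ∃ g : ZMod 2 × ZMod n, ∃ t ∈ S, v = transl (πQ (ZMod n)) g t}) :
    (∑ a ∈ Finset.range n, (2 ^ n.gcd a - 2)) / (2 * n) ≤ S.card := by
  have hA : Odd (Fintype.card (ZMod n)) := by rwa [ZMod.card]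
  have h := oddSlice_law (ZMod n) hA S hS
  have hpos : 0 < 2 * n := by have := NeZero.pos n; omega
  rw [← card_orbitsA_zmod_mul n hn, Nat.mul_div_cancel _ hpos]
  exact h

/-- **`μ(ℤ/18) ≥ 29`.** [folklore] -/
theorem zmod_eighteen_law (S : Finset (Pt (AbQ (ZMod 9)) → ℤ))
    (hS : hodgeLattice (πQ (ZMod 9)) (φQ (ZMod 9)) ≤
      pairs ⊔ Submodule.span ℤ {v | ∃ g : ZMod 2 × ZMod 9, ∃ t ∈ S, v = transl (πQ (ZMod 9)) g t}) :
    29 ≤ S.card := by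
  have hA : Odd (Fintype.card (ZMod 9)) := by rw [ZMod.card]; decide
  have h := oddSlice_law (ZMod 9) hA S hS
  rwa [card_orbitsA_zmod_nine] at h

/-- **`μ(ℤ/30) ≥ 1095`.** [folklore] -/
theorem zmod_thirty_law (S : Finset (Pt (AbQ (ZMod 15)) → ℤ))
    (hS : hodgeLattice (πQ (ZMod 15)) (φQ (ZMod 15)) ≤
      pairs ⊔ Submodule.span ℤ {v | ∃ g : ZMod 2 × ZMod 15, ∃ t ∈ S, v = transl (πQ (ZMod 15)) g t}) :
    1095 ≤ S.card := by
  have hA : Odd (Fintype.card (ZMod 15)) := by rw [ZMod.card]; decide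
  have h := oddSlice_law (ZMod 15) hA S hS
  rwa [card_orbitsA_zmod_fifteen] at h

/-- **`μ(ℤ/6 × ℤ/3) ≥ 31`.** [folklore] -/
theorem zmod_six_three_law (S : Finset (Pt (AbQ (ZMod 3 × ZMod 3)) → ℤ))
    (hS : hodgeLattice (πQ (ZMod 3 × ZMod 3)) (φQ (ZMod 3 × ZMod 3)) ≤
      pairs ⊔ Submodule.span ℤ {v | ∃ g : ZMod 2 × (ZMod 3 × ZMod 3), ∃ t ∈ S, v = transl (πQ (ZMod 3 × ZMod 3)) g t}) :
    31 ≤ S.card := by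
  have hA : Odd (Fintype.card (ZMod 3 × ZMod 3)) := by rw [Fintype.card_prod, ZMod.card]; decide
  have h := oddSlice_law (ZMod 3 × ZMod 3) hA S hS
  rwa [card_orbitsA_zmod_three_sq] at h

end Cyclic

end Summit.HodgeConjecture.CorCM.Census.OddDegreeParityLaw
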